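import Summits.QuantumFields.YangMills.Theorems.UnitScaleTiltProp7SectET3WilsonHessianT3CetaRows
import Summits.QuantumFields.YangMills.Theorems.UnitScaleTiltProp7SecondOrderDictT3
import Literature.MathematicalPhysics.QuantumFieldTheory.Balaban1983to89.B9Eq39Adjoint
import HarnessLib

/-!
# Route `UnitScaleTilt`, crux «MinimiserStabilityRegPr» (stmt-QuantumFields-19200, stub EX), node N06(d = 3), route (α) — LAYER 0, ROWS (def-free), «Δ310-EXPLICIT» PART (A):
# **THE SECOND-ORDER EXPANSION OF BRICK L0b's COMPLEXIFIED WILSON ACTION ALONG THE CHART, `actionRe (chartU U₀ (z•Z)) = actionRe (bgUnits U₀) + z·𝔩 + z²·𝔮 + O(z³)`,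
# WITH [Balaban1985BackgroundPropagators] (3.10)'s QUADRATIC TERM `𝔮` IN CLOSED LATTICE LETTERS** — `𝔮 = −½Σ_p [τ((D¹_{U₀}Z)(p)²·Re U₀(∂p)) + τ(i·Σ_{b₁≺b₂}[Z′(b₁),Z′(b₂)]·Im U₀(∂p))]`,
# `τ = ½tr`, EXACT background — lit ✓`B9Eq39Adjoint.summand_split` ((3.7) → (3.10)∕(3.11)∕(3.12), third-order remainder `rem3`) READ AT THE T³ MEMBER through ★px16's dictionary

Cell `ym3-torus`, width seat `ym3-torus-px5` (gen 0; FILL-TO-CAP «width 5»); EX-knit namer ★ym-ust-19200-w2 g5 GO (G6) 2026-08-28 16:51:55Z «px5: Δ310-EXPLICIT YES»; LOCATE memo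
`HOME/ym3-torus-px5/LOCATE-DELTA310-EXPLICIT-px5.md` §3 (A).  THEOREMS ONLY (0 `def`, 0 `sorry`); `--supports stmt-QuantumFields-19200 --as helper`; count-neutral.  YM₃ on T³ is
ladder rung R3, NOT the Clay problem; nothing here is a claim about a stub, a crux, d = 4 or the mass gap; nothing of [Balaban1985BackgroundPropagators] is asserted beyond lit-balaban's
kernel-checked algebra (✓`summand_split`, ✓`wil_plaqU_prodCfg`, ✓`norm_rem3_le`), which this file only READS in brick L0b's letters.

THE PRINT.  [Balaban1985BackgroundPropagators] (3.7) p. 391, (3.10)–(3.12) p. 392: *«A^η(exp iηA U) = A^η(U) + ⟨A, J⟩ + ½⟨A, ΔA⟩ + ⋯ (3.12)»*, *«⟨A, ΔA⟩ = ⟨A, D*DA⟩ + ⟨A, Δ′A⟩ … (3.10)»*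
with `⟨A, Δ′A⟩ = Σ_p η^d [tr((D¹A)(p))² η⁻²(Re U(∂p) − 1) + tr Σ_{b₁≺b₂} i[A′(b₁), A′(b₂)] η⁻² Im U(∂p)]`; brick L0b (✓`Prop7SectET3WilsonHessianT3` §3): `actionRe W = Σ_p (1 − ¼(tr W(∂p) + tr W(∂p)⁻¹))`,
`chartU U₀ X b = e^{X(b)}U₀(b)`, `hessFormRe U₀ = D²(actionRe ∘ chartU U₀)(0)`, ✓`iteratedDeriv_two_actionRe_line : ∂²_z actionRe (chartU U₀ (z•Z))|₀ = hessFormRe U₀ Z Z` — so the `z²`-coefficient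
below is HALF of `hessFormRe U₀ Z Z` (part (B) of the memo extracts it).

WHAT IS PROVED (member `F`, `K`; `U₀ : GaugeField (F.P K) 0 SU(2)`; `Z : PBond (F.P K) 0 → M₂(ℂ)` ANY exponent field; `z : ℂ`; lit lattice `T := torusT (F.P K) 0`,
`U := fun μ x ↦ bgUnits F K U₀ ⟨x, μ⟩`, `A := formComp Z`; `τ := ½·tr` as `LinearMap.toContinuousLinearMap ((2:ℂ)⁻¹ • Matrix.traceLinearMap …)`; ns `…Theorems.Prop7SectET3ActionQuad`).
* §1 `halfTrace_apply`∕`halfTrace_one`∕`halfTrace_comm` (the tracial `τ`), `wil_halfTrace` (`wil τ W = 1 − ¼(tr W + tr W⁻¹)`), ★`actionRe_eq_sum_wil` (brick L0b's `actionRe` IS lit's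
  `Σ_p wil τ (plaqU T (·) p)` read through ★px16's `plaqU_torusT_eq_holT`).
* §2 ★`chartU_smul_eq_prodCfg` (`(e^{zZ(b)}U₀(b))_b` IS lit's product configuration `prodCfg U 1 ((−iz)•A)`), `lettersA_smul`.
* §3 ★★`wil_chartU_sub_wil_eq` — ONE PLAQUETTE: `wil τ ((e^{zZ}U₀)(∂p)) − wil τ (U₀(∂p)) = z·(−i·τ(C·Im W)) + z²·(−½[τ(C·C·Re W) + τ((i•K)·Im W)]) + rem3`, `C = (D¹_{U₀}Z)(p)`
  (= `(lettersA).sum`, ✓`sum_lettersA`), `K = commSum (lettersA)`, `W = U₀(∂p)`, `Re∕Im` = `reC∕imC` (✓`summand_split` at `(η, d, A) := (1, 4, (−iz)•A)`, ✓`curl_smul`, ✓`commSum_map_smul`).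
* §4 ★★★`actionRe_chartU_smul_eq` — THE EXPANSION summed over the plaquettes of the member, and ★★`norm_rem3_chartU_le` — the remainder is THIRD ORDER:
  `‖rem3 …‖ ≤ ‖z‖³·(½‖τ‖(‖W‖ + ‖W⁻¹‖)·(s³∕6)·e^{s})` for `‖z‖ ≤ 1`, `s = size (lettersA … A …)` (✓`norm_rem3_le`, ✓`size_map_smul`, ✓`expTail_three_le`).
HONEST SCOPE.  Finite algebra + one elementary inequality over landed lit rows; the background is EXACT (no smallness, no unitarity used); the identification `z²`-coefficient
`= ½·hessFormRe U₀ Z Z` (calculus) and the operator form of `DeltaEta` are parts (B)∕(C) of the memo, NOT here.  Nothing continuum ∕ OS ∕ mass-gap ∕ Clay.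

References: T. Bałaban, CMP **99** (1985) 389–434 [Balaban1985BackgroundPropagators] ((3.1)–(3.2) p.390, (3.4)–(3.7) p.391, (3.10)–(3.12) p.392); CMP **102** (1985) 277–309
[Balaban1985Variational] ((19) p.281, (135)–(140) pp.298–299).
-/

set_option autoImplicit false

noncomputable section

open scoped Matrix.Norms.L2Operator BigOperators
open Complex (I)

namespace Summit.QuantumFields.YangMills.Theorems.Prop7SectET3ActionQuad

open Literature.MathematicalPhysics.QuantumFieldTheory.Balaban1983to89
open Literature.MathematicalPhysics.QuantumFieldTheory.Balaban1983to89.T3ContinuumYM3Torus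
open NormedSpace (exp)
open T3SectALandauChart (formComp bgUnits)
open B9TorusCalculus (torusT)
open B7Prop1Explicit (expUnit val_expUnit plaqWord)
open B9Eq37Insertion (reC imC wil holU val_holU rem)
open B9Eq39Adjoint (R curl lettersA sum_lettersA curl_smul plaqU posPlaq prodCfg fluct rem3 summand_split wil_plaqU_prodCfg norm_rem3_le)
open Beta.TransportVertices (holonomy holonomy_cons holonomy_nil commSum commSum_map_smul size size_map_smul expTail expTail_three_le)
open Summit.QuantumFields.YangMills.Theorems.Prop7SectET3WilsonHessian (chartU actionRe actionRe_def plaqU_def)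
open Summit.QuantumFields.YangMills.Theorems.Prop7SecondOrderDict (plaqU_torusT_eq_holT)

variable {F : T3Family} {K : ℕ}

/-! ## §1 The tracial functional `τ = ½tr` and brick L0b's action as lit's `Σ_p wil τ` -/

/-- `τ X = ½·tr X`. [folklore] -/
theorem halfTrace_apply (X : Matrix (Fin 2) (Fin 2) ℂ) :
    ((2 : ℂ)⁻¹ • LinearMap.toContinuousLinearMap (Matrix.traceLinearMap (Fin 2) ℂ ℂ)) X = (2 : ℂ)⁻¹ * Matrix.trace X := by
  simp [Matrix.traceLinearMap_apply]

/-- `τ X = ½·tr X`, read on the underlying linear map. [folklore] -/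
theorem halfTrace_apply' (X : Matrix (Fin 2) (Fin 2) ℂ) :
    ((2 : ℂ)⁻¹ • ((LinearMap.toContinuousLinearMap (Matrix.traceLinearMap (Fin 2) ℂ ℂ) : Matrix (Fin 2) (Fin 2) ℂ →L[ℂ] ℂ) :
      Matrix (Fin 2) (Fin 2) ℂ →ₗ[ℂ] ℂ)) X = (2 : ℂ)⁻¹ * Matrix.trace X := by
  simp [Matrix.traceLinearMap_apply]

/-- `τ 1 = 1` on `M₂(ℂ)` (normalised trace). [folklore] -/
theorem halfTrace_one :
    ((2 : ℂ)⁻¹ • LinearMap.toContinuousLinearMap (Matrix.traceLinearMap (Fin 2) ℂ ℂ)) (1 : Matrix (Fin 2) (Fin 2) ℂ) = 1 := by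
  rw [halfTrace_apply, Matrix.trace_one, Fintype.card_fin]
  norm_num

/-- `τ` is tracial: `τ(ab) = τ(ba)`. [folklore] -/
theorem halfTrace_comm (a b : Matrix (Fin 2) (Fin 2) ℂ) :
    (((2 : ℂ)⁻¹ • LinearMap.toContinuousLinearMap (Matrix.traceLinearMap (Fin 2) ℂ ℂ)) : Matrix (Fin 2) (Fin 2) ℂ →ₗ[ℂ] ℂ) (a * b)
      = (((2 : ℂ)⁻¹ • LinearMap.toContinuousLinearMap (Matrix.traceLinearMap (Fin 2) ℂ ℂ)) : Matrix (Fin 2) (Fin 2) ℂ →ₗ[ℂ] ℂ) (b * a) := by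
  simp [Matrix.traceLinearMap_apply, Matrix.trace_mul_comm a b]

/-- `wil τ W = 1 − ¼(tr W + tr W⁻¹)` for `τ = ½tr` — lit's complexified plaquette action IS brick L0b's summand. [cite: Balaban1985BackgroundPropagators, (3.1) p.390, p.391] -/
theorem wil_halfTrace (W : (Matrix (Fin 2) (Fin 2) ℂ)ˣ) :
    wil (((2 : ℂ)⁻¹ • LinearMap.toContinuousLinearMap (Matrix.traceLinearMap (Fin 2) ℂ ℂ)) : Matrix (Fin 2) (Fin 2) ℂ →ₗ[ℂ] ℂ) W
      = 1 - (4 : ℂ)⁻¹ * (Matrix.trace (W : Matrix (Fin 2) (Fin 2) ℂ) + Matrix.trace (((W⁻¹ : (Matrix (Fin 2) (Fin 2) ℂ)ˣ) : Matrix (Fin 2) (Fin 2) ℂ))) := by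
  simp [wil, reC, Matrix.traceLinearMap_apply, Matrix.trace_smul, Matrix.trace_add, Matrix.trace_one]
  ring

/-- ★ **BRICK L0b's `actionRe` IS lit's `Σ_p wil τ (plaqU T (·) p)`** at `τ = ½tr`, read through ★px16's `plaqU_torusT_eq_holT` and brick L0b's `plaqU_def`.
[cite: Balaban1985BackgroundPropagators, (3.1) p.390, (3.7) p.391] -/
theorem actionRe_eq_sum_wil (W : PBond (F.P K) 0 → (Matrix (Fin 2) (Fin 2) ℂ)ˣ) :
    actionRe F K W = ∑ p : Plaq (F.P K) 0,
      wil (((2 : ℂ)⁻¹ • LinearMap.toContinuousLinearMap (Matrix.traceLinearMap (Fin 2) ℂ ℂ)) : Matrix (Fin 2) (Fin 2) ℂ →ₗ[ℂ] ℂ)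
        (plaqU (torusT (F.P K) 0) (fun μ x => W ⟨x, μ⟩) p.μ p.ν p.src) := by
  rw [actionRe_def]
  refine Finset.sum_congr rfl fun p _ => ?_
  rw [wil_halfTrace, plaqU_torusT_eq_holT, ← plaqU_def]

/-! ## §2 The chart configuration IS lit's product configuration -/

/-- ★ **`(e^{zZ(b)}U₀(b))_b = prodCfg U 1 ((−iz)•A)`**: brick L0b's chart configuration along the complex line `z ↦ z•Z` IS lit's `U′U₀`, `U′ = exp(i·1·A′)` with `A′ = (−iz)•A`,
`A = formComp Z`. [cite: Balaban1985BackgroundPropagators, p.390, (3.12) p.392] -/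
theorem chartU_smul_eq_prodCfg (U₀ : GaugeField (F.P K) 0 (Matrix.specialUnitaryGroup (Fin 2) ℂ)) (Z : PBond (F.P K) 0 → Matrix (Fin 2) (Fin 2) ℂ) (z : ℂ) :
    (fun μ x => chartU F K U₀ (z • Z) ⟨x, μ⟩) = prodCfg (fun μ x => bgUnits F K U₀ ⟨x, μ⟩) 1 ((-(I * z)) • formComp Z) := by
  funext μ x
  ext i j
  have hz : I * -(I * z) = z := by
    rw [mul_neg, ← mul_assoc, Complex.I_mul_I]; ring
  simp only [chartU, Units.val_mul, val_expUnit, Pi.smul_apply, prodCfg, fluct, val_holU, holonomy_cons, holonomy_nil, mul_one, smul_smul,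
    formComp, Complex.ofReal_one, hz]

/-- `lettersA` is linear in the field: `lettersA (c•A) = (lettersA A).map (c•·)`. [cite: Balaban1985BackgroundPropagators, (3.2) p.390] -/
theorem lettersA_smul {S ι : Type*} (T : ι → Equiv.Perm S) (U : ι → S → (Matrix (Fin 2) (Fin 2) ℂ)ˣ) (c : ℂ) (A : ι → S → Matrix (Fin 2) (Fin 2) ℂ)
    (μ ν : ι) (x : S) :
    lettersA T U (c • A) μ ν x = (lettersA T U A μ ν x).map (c • ·) := by
  simp only [lettersA, Pi.smul_apply, List.map_cons, List.map_nil, smul_neg, B9Eq39Adjoint.R_smul]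

/-! ## §3 One plaquette: the expansion in `z` with (3.10)'s quadratic term in closed letters -/

/-- ★★ **ONE PLAQUETTE OF (3.7) → (3.10)∕(3.11)∕(3.12) ALONG THE CHART**: with `C := (D¹_{U₀}Z)(p)` (the transported letter sum), `K := commSum` of the four letters, `W := U₀(∂p)`,
`wil τ ((e^{zZ}U₀)(∂p)) − wil τ (U₀(∂p)) = z·(−i·τ(C·Im W)) + z²·(−½[τ(C·C·Re W) + τ((i•K)·Im W)]) + rem3(z)` — the `z²`-coefficient is (3.10)'s `½⟨Z, ΔZ⟩`-summand
(`τ(C²) + τ(C²(Re W − 1)) = τ(C²·Re W)`) at the exponent direction `Z = iA`. [cite: Balaban1985BackgroundPropagators, (3.7) p.391, (3.10)–(3.12) p.392] -/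
theorem wil_chartU_sub_wil_eq (U₀ : GaugeField (F.P K) 0 (Matrix.specialUnitaryGroup (Fin 2) ℂ)) (Z : PBond (F.P K) 0 → Matrix (Fin 2) (Fin 2) ℂ) (z : ℂ)
    (μ ν : Fin (F.P K).d) (x : Site (F.P K) 0) :
    wil (((2 : ℂ)⁻¹ • LinearMap.toContinuousLinearMap (Matrix.traceLinearMap (Fin 2) ℂ ℂ)) : Matrix (Fin 2) (Fin 2) ℂ →ₗ[ℂ] ℂ)
        (plaqU (torusT (F.P K) 0) (fun μ x => chartU F K U₀ (z • Z) ⟨x, μ⟩) μ ν x)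
      - wil (((2 : ℂ)⁻¹ • LinearMap.toContinuousLinearMap (Matrix.traceLinearMap (Fin 2) ℂ ℂ)) : Matrix (Fin 2) (Fin 2) ℂ →ₗ[ℂ] ℂ)
        (plaqU (torusT (F.P K) 0) (fun μ x => bgUnits F K U₀ ⟨x, μ⟩) μ ν x)
      = z * (-(I * (((2 : ℂ)⁻¹ • LinearMap.toContinuousLinearMap (Matrix.traceLinearMap (Fin 2) ℂ ℂ)) : Matrix (Fin 2) (Fin 2) ℂ →ₗ[ℂ] ℂ)
            (curl (torusT (F.P K) 0) (fun μ x => bgUnits F K U₀ ⟨x, μ⟩) (formComp Z) μ ν x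
              * imC (plaqU (torusT (F.P K) 0) (fun μ x => bgUnits F K U₀ ⟨x, μ⟩) μ ν x))))
        + z ^ 2 * (-(2⁻¹ * ((((2 : ℂ)⁻¹ • LinearMap.toContinuousLinearMap (Matrix.traceLinearMap (Fin 2) ℂ ℂ)) : Matrix (Fin 2) (Fin 2) ℂ →ₗ[ℂ] ℂ)
            (curl (torusT (F.P K) 0) (fun μ x => bgUnits F K U₀ ⟨x, μ⟩) (formComp Z) μ ν x
              * curl (torusT (F.P K) 0) (fun μ x => bgUnits F K U₀ ⟨x, μ⟩) (formComp Z) μ ν x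
              * reC (plaqU (torusT (F.P K) 0) (fun μ x => bgUnits F K U₀ ⟨x, μ⟩) μ ν x))
          + (((2 : ℂ)⁻¹ • LinearMap.toContinuousLinearMap (Matrix.traceLinearMap (Fin 2) ℂ ℂ)) : Matrix (Fin 2) (Fin 2) ℂ →ₗ[ℂ] ℂ)
            ((I • commSum (lettersA (torusT (F.P K) 0) (fun μ x => bgUnits F K U₀ ⟨x, μ⟩) (formComp Z) μ ν x))
              * imC (plaqU (torusT (F.P K) 0) (fun μ x => bgUnits F K U₀ ⟨x, μ⟩) μ ν x)))))
        + rem3 (torusT (F.P K) 0) (fun μ x => bgUnits F K U₀ ⟨x, μ⟩) 1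
            (((2 : ℂ)⁻¹ • LinearMap.toContinuousLinearMap (Matrix.traceLinearMap (Fin 2) ℂ ℂ)) : Matrix (Fin 2) (Fin 2) ℂ →ₗ[ℂ] ℂ)
            ((-(I * z)) • formComp Z) μ ν x := by
  set τ : Matrix (Fin 2) (Fin 2) ℂ →ₗ[ℂ] ℂ :=
    (((2 : ℂ)⁻¹ • LinearMap.toContinuousLinearMap (Matrix.traceLinearMap (Fin 2) ℂ ℂ)) : Matrix (Fin 2) (Fin 2) ℂ →ₗ[ℂ] ℂ) with hτ_def
  set T := torusT (F.P K) 0 with hT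
  set U : Fin (F.P K).d → Site (F.P K) 0 → (Matrix (Fin 2) (Fin 2) ℂ)ˣ := fun μ x => bgUnits F K U₀ ⟨x, μ⟩ with hU
  set A : Fin (F.P K).d → Site (F.P K) 0 → Matrix (Fin 2) (Fin 2) ℂ := (-(I * z)) • formComp Z with hA
  have hτ : ∀ a b : Matrix (Fin 2) (Fin 2) ℂ, τ (a * b) = τ (b * a) := fun a b => by rw [hτ_def]; exact halfTrace_comm a b
  -- the chart configuration is the product configuration; lit's (3.1) rotation and `summand_split` at `(η, d) := (1, 4)`
  have hcfg : (fun μ x => chartU F K U₀ (z • Z) ⟨x, μ⟩) = prodCfg U 1 A := by rw [hU, hA]; exact chartU_smul_eq_prodCfg U₀ Z z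
  have hsplit := summand_split T U τ hτ (1 : ℝ) one_ne_zero (d := 4) le_rfl A μ ν x
  simp only [Nat.sub_self, pow_zero, one_mul, Complex.ofReal_one, inv_one, one_pow, one_smul] at hsplit
  rw [hcfg, wil_plaqU_prodCfg T U τ hτ 1 A μ ν x, hsplit]
  -- substitute `A = (−iz)•formComp Z`: `curlη 1 A = curl A = (−iz)•curl (formComp Z)`, `commSum (lettersA A) = (−iz)²•commSum (lettersA (formComp Z))`
  have hcurlη : B9Eq39Adjoint.curlη T U 1 A μ ν x = (-(I * z)) • curl T U (formComp Z) μ ν x := by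
    rw [B9Eq39Adjoint.curlη, Complex.ofReal_one, inv_one, one_smul, hA, curl_smul]
  have hcurl : curl T U A μ ν x = (-(I * z)) • curl T U (formComp Z) μ ν x := by rw [hA, curl_smul]
  have hcomm : commSum (lettersA T U A μ ν x) = (-(I * z)) ^ 2 • commSum (lettersA T U (formComp Z) μ ν x) := by
    rw [hA, lettersA_smul, commSum_map_smul]
  rw [hcurlη, hcurl, hcomm]
  simp only [smul_mul_assoc, mul_smul_comm, map_smul, smul_eq_mul, map_sub, mul_sub, mul_one, smul_smul]
  have hI2 : (-(I * z)) * (-(I * z)) = -(z ^ 2) := by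
    rw [neg_mul_neg, mul_mul_mul_comm, Complex.I_mul_I]; ring
  have hI2' : (-(I * z)) ^ 2 = -(z ^ 2) := by rw [pow_two, hI2]
  rw [hI2']
  ring_nf
  rw [Complex.I_sq]
  ring

/-! ## §4 The expansion summed over the member's plaquettes, and the third-order remainder -/

/-- ★★★ **THE SECOND-ORDER EXPANSION OF BRICK L0b's ACTION ALONG THE CHART**: `actionRe (chartU U₀ (z•Z)) = actionRe (bgUnits U₀) + z·𝔩 + z²·𝔮 + Σ_p rem3_p(z)` with
`𝔩 = −i·Σ_p τ(C_p·Im W_p)` (the current pairing (3.11)) and **`𝔮 = −½·Σ_p [τ(C_p·C_p·Re W_p) + τ((i•K_p)·Im W_p)]`** = `−½·⟨Z, ΔZ⟩` of (3.10)∕(3.12) at the exponent direction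
(`C_p = (D¹_{U₀}Z)(p)`, `K_p = Σ_{b₁≺b₂}[Z′(b₁), Z′(b₂)]`, `W_p = U₀(∂p)`, `τ = ½tr`), EXACT background. [cite: Balaban1985BackgroundPropagators, (3.10)–(3.12) p.392, (3.7) p.391] -/
theorem actionRe_chartU_smul_eq (U₀ : GaugeField (F.P K) 0 (Matrix.specialUnitaryGroup (Fin 2) ℂ)) (Z : PBond (F.P K) 0 → Matrix (Fin 2) (Fin 2) ℂ) (z : ℂ) :
    actionRe F K (chartU F K U₀ (z • Z)) = actionRe F K (bgUnits F K U₀)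
      + z * ∑ p : Plaq (F.P K) 0, -(I * (((2 : ℂ)⁻¹ • LinearMap.toContinuousLinearMap (Matrix.traceLinearMap (Fin 2) ℂ ℂ)) : Matrix (Fin 2) (Fin 2) ℂ →ₗ[ℂ] ℂ)
            (curl (torusT (F.P K) 0) (fun μ x => bgUnits F K U₀ ⟨x, μ⟩) (formComp Z) p.μ p.ν p.src * imC (plaqU (torusT (F.P K) 0) (fun μ x => bgUnits F K U₀ ⟨x, μ⟩) p.μ p.ν p.src)))
      + z ^ 2 * ∑ p : Plaq (F.P K) 0, -(2⁻¹ * ((((2 : ℂ)⁻¹ • LinearMap.toContinuousLinearMap (Matrix.traceLinearMap (Fin 2) ℂ ℂ)) : Matrix (Fin 2) (Fin 2) ℂ →ₗ[ℂ] ℂ)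
            (curl (torusT (F.P K) 0) (fun μ x => bgUnits F K U₀ ⟨x, μ⟩) (formComp Z) p.μ p.ν p.src * curl (torusT (F.P K) 0) (fun μ x => bgUnits F K U₀ ⟨x, μ⟩) (formComp Z) p.μ p.ν p.src
              * reC (plaqU (torusT (F.P K) 0) (fun μ x => bgUnits F K U₀ ⟨x, μ⟩) p.μ p.ν p.src))
          + (((2 : ℂ)⁻¹ • LinearMap.toContinuousLinearMap (Matrix.traceLinearMap (Fin 2) ℂ ℂ)) : Matrix (Fin 2) (Fin 2) ℂ →ₗ[ℂ] ℂ)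
            ((I • commSum (lettersA (torusT (F.P K) 0) (fun μ x => bgUnits F K U₀ ⟨x, μ⟩) (formComp Z) p.μ p.ν p.src)) * imC (plaqU (torusT (F.P K) 0) (fun μ x => bgUnits F K U₀ ⟨x, μ⟩) p.μ p.ν p.src))))
      + ∑ p : Plaq (F.P K) 0, rem3 (torusT (F.P K) 0) (fun μ x => bgUnits F K U₀ ⟨x, μ⟩) 1 (((2 : ℂ)⁻¹ • LinearMap.toContinuousLinearMap (Matrix.traceLinearMap (Fin 2) ℂ ℂ)) : Matrix (Fin 2) (Fin 2) ℂ →ₗ[ℂ] ℂ) ((-(I * z)) • formComp Z) p.μ p.ν p.src := by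
  rw [actionRe_eq_sum_wil, actionRe_eq_sum_wil, Finset.mul_sum, Finset.mul_sum, ← Finset.sum_add_distrib, ← Finset.sum_add_distrib,
    ← Finset.sum_add_distrib]
  refine Finset.sum_congr rfl fun p _ => ?_
  have h := wil_chartU_sub_wil_eq U₀ Z z p.μ p.ν p.src
  linear_combination h

/-- ★★ **THE REMAINDER IS THIRD ORDER IN `z`**: for `‖z‖ ≤ 1`, one plaquette's `rem3` of the expansion is bounded by
`‖z‖³ · (½‖τ‖(‖W_p‖ + ‖W_p⁻¹‖)·(s_p³∕6)·e^{s_p})`, `s_p = Σ_{b⊂∂p}‖Z′(b)‖` (lit ✓`norm_rem3_le` + ✓`expTail_three_le` + ✓`size_map_smul`). [cite: Balaban1985BackgroundPropagators, (3.12) p.392] -/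
theorem norm_rem3_chartU_le (U₀ : GaugeField (F.P K) 0 (Matrix.specialUnitaryGroup (Fin 2) ℂ)) (Z : PBond (F.P K) 0 → Matrix (Fin 2) (Fin 2) ℂ) {z : ℂ}
    (hz : ‖z‖ ≤ 1) (μ ν : Fin (F.P K).d) (x : Site (F.P K) 0) :
    ‖rem3 (torusT (F.P K) 0) (fun μ x => bgUnits F K U₀ ⟨x, μ⟩) 1 (((2 : ℂ)⁻¹ • LinearMap.toContinuousLinearMap (Matrix.traceLinearMap (Fin 2) ℂ ℂ)) : Matrix (Fin 2) (Fin 2) ℂ →ₗ[ℂ] ℂ) ((-(I * z)) • formComp Z) μ ν x‖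
      ≤ ‖z‖ ^ 3 * (2⁻¹ * ‖((2 : ℂ)⁻¹ • LinearMap.toContinuousLinearMap (Matrix.traceLinearMap (Fin 2) ℂ ℂ))‖
          * (‖((plaqU (torusT (F.P K) 0) (fun μ x => bgUnits F K U₀ ⟨x, μ⟩) μ ν x : (Matrix (Fin 2) (Fin 2) ℂ)ˣ) : Matrix (Fin 2) (Fin 2) ℂ)‖
              + ‖(((plaqU (torusT (F.P K) 0) (fun μ x => bgUnits F K U₀ ⟨x, μ⟩) μ ν x)⁻¹ : (Matrix (Fin 2) (Fin 2) ℂ)ˣ) : Matrix (Fin 2) (Fin 2) ℂ)‖)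
          * (size (lettersA (torusT (F.P K) 0) (fun μ x => bgUnits F K U₀ ⟨x, μ⟩) (formComp Z) μ ν x) ^ 3 / 6
              * Real.exp (size (lettersA (torusT (F.P K) 0) (fun μ x => bgUnits F K U₀ ⟨x, μ⟩) (formComp Z) μ ν x)))) := by
  set s : ℝ := size (lettersA (torusT (F.P K) 0) (fun μ x => bgUnits F K U₀ ⟨x, μ⟩) (formComp Z) μ ν x) with hs_def
  have hs : 0 ≤ s := by
    rw [hs_def, size]
    exact List.sum_nonneg (by
      intro a ha
      obtain ⟨b, _, rfl⟩ := List.mem_map.mp ha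
      exact norm_nonneg _)
  have h := norm_rem3_le (torusT (F.P K) 0) (fun μ x => bgUnits F K U₀ ⟨x, μ⟩) ((2 : ℂ)⁻¹ • LinearMap.toContinuousLinearMap (Matrix.traceLinearMap (Fin 2) ℂ ℂ)) 1 ((-(I * z)) • formComp Z) μ ν x
  rw [lettersA_smul, size_map_smul, abs_one, one_mul] at h
  have hcz : ‖-(I * z)‖ = ‖z‖ := by rw [norm_neg, norm_mul, Complex.norm_I, one_mul]
  rw [hcz] at h
  -- `expTail 3 (‖z‖·s) ≤ (‖z‖s)³∕6·e^{‖z‖s} ≤ ‖z‖³·(s³∕6·e^s)`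
  have hzs : 0 ≤ ‖z‖ * s := mul_nonneg (norm_nonneg _) hs
  have htail : expTail 3 (‖z‖ * s) ≤ ‖z‖ ^ 3 * (s ^ 3 / 6 * Real.exp s) := by
    calc expTail 3 (‖z‖ * s) ≤ (‖z‖ * s) ^ 3 / 6 * Real.exp (‖z‖ * s) := expTail_three_le hzs
      _ ≤ (‖z‖ * s) ^ 3 / 6 * Real.exp s := by
          gcongr
          calc ‖z‖ * s ≤ 1 * s := mul_le_mul_of_nonneg_right hz hs
            _ = s := one_mul s
      _ = ‖z‖ ^ 3 * (s ^ 3 / 6 * Real.exp s) := by ring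
  have hpre : 0 ≤ 2⁻¹ * ‖((2 : ℂ)⁻¹ • LinearMap.toContinuousLinearMap (Matrix.traceLinearMap (Fin 2) ℂ ℂ))‖
      * (‖((plaqU (torusT (F.P K) 0) (fun μ x => bgUnits F K U₀ ⟨x, μ⟩) μ ν x : (Matrix (Fin 2) (Fin 2) ℂ)ˣ) : Matrix (Fin 2) (Fin 2) ℂ)‖
          + ‖(((plaqU (torusT (F.P K) 0) (fun μ x => bgUnits F K U₀ ⟨x, μ⟩) μ ν x)⁻¹ : (Matrix (Fin 2) (Fin 2) ℂ)ˣ) : Matrix (Fin 2) (Fin 2) ℂ)‖) := by positivity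
  calc ‖rem3 (torusT (F.P K) 0) (fun μ x => bgUnits F K U₀ ⟨x, μ⟩) 1 (((2 : ℂ)⁻¹ • LinearMap.toContinuousLinearMap (Matrix.traceLinearMap (Fin 2) ℂ ℂ)) : Matrix (Fin 2) (Fin 2) ℂ →ₗ[ℂ] ℂ) ((-(I * z)) • formComp Z) μ ν x‖
      ≤ 2⁻¹ * ‖((2 : ℂ)⁻¹ • LinearMap.toContinuousLinearMap (Matrix.traceLinearMap (Fin 2) ℂ ℂ))‖
          * (‖((plaqU (torusT (F.P K) 0) (fun μ x => bgUnits F K U₀ ⟨x, μ⟩) μ ν x : (Matrix (Fin 2) (Fin 2) ℂ)ˣ) : Matrix (Fin 2) (Fin 2) ℂ)‖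
              + ‖(((plaqU (torusT (F.P K) 0) (fun μ x => bgUnits F K U₀ ⟨x, μ⟩) μ ν x)⁻¹ : (Matrix (Fin 2) (Fin 2) ℂ)ˣ) : Matrix (Fin 2) (Fin 2) ℂ)‖)
          * expTail 3 (‖z‖ * s) := h
    _ ≤ 2⁻¹ * ‖((2 : ℂ)⁻¹ • LinearMap.toContinuousLinearMap (Matrix.traceLinearMap (Fin 2) ℂ ℂ))‖
          * (‖((plaqU (torusT (F.P K) 0) (fun μ x => bgUnits F K U₀ ⟨x, μ⟩) μ ν x : (Matrix (Fin 2) (Fin 2) ℂ)ˣ) : Matrix (Fin 2) (Fin 2) ℂ)‖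
              + ‖(((plaqU (torusT (F.P K) 0) (fun μ x => bgUnits F K U₀ ⟨x, μ⟩) μ ν x)⁻¹ : (Matrix (Fin 2) (Fin 2) ℂ)ˣ) : Matrix (Fin 2) (Fin 2) ℂ)‖)
          * (‖z‖ ^ 3 * (s ^ 3 / 6 * Real.exp s)) := mul_le_mul_of_nonneg_left htail hpre
    _ = _ := by ring

end Summit.QuantumFields.YangMills.Theorems.Prop7SectET3ActionQuad

end
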